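/-
Copyright: harness cell b2b-lgcu-borel (gen 19).  Honest framing: the VALUE here is a THEOREM
(structural laws on every hypothetical witness of the crux) — NOT summit progress; the crux item
`SubgroupIdentityDesigns` (stmt-MatrixMultiplication-14079) stays open and untouched.
-/
import Mathlib
import Summits.MatrixMultiplication.MatrixMultiplication.Theorems.LevelTwoBeatsCubes.Negative.GradedNeumannCount
import Summits.MatrixMultiplication.MatrixMultiplication.Theorems.SubgroupIdentityDesigns.Negative.PackingBridge

/-!
# The two graded Neumann counts of a witness and the volume law `V ≤ u·D − u³ + u²`

Route `LevelGradedCohnUmans`, crux `SubgroupIdentityDesigns`, negative side; ALL primes `p`, all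
dimensions `m`, all levels `k`.

The tree quotes the graded Neumann counts (`LevelTwoBeatsCubes.Negative.packing_X/_Z`) only
through the symmetric wall `2V² ≤ (dim J)³` (`PackingBridge.crux_walls`).  Kept separately they say
more.  For a subgroup-TPP triple `(H₁, H₂, H₃)` of `GL_m(𝔽_p)` with a level-`k` identity design,
`x = |H₁|`, `y = |H₂|`, `z = |H₃|`, `D = dim F_k|_G` (`= finrank (levelSubmodule p m k)`):

* `crux_neumann` : **`x z + x (y − 1) ≤ D` and `x z + (y − 1) z ≤ D`** (the bi-invariant test
  function of `PackingBridge.exists_test` fed to the two one-sided packing counts);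
* `crux_pair_walls` : the three pair walls **`x y ≤ D`, `y z ≤ D`, `x z ≤ D`**;
* `crux_volume_law` : with `u = min (x, z)`, **`V + u² (u − 1) ≤ u · D`** and `u² ≤ D` — i.e.
  `V ≤ u D − u³ + u²`, whose maximum over real `u` is `(2/(3√3)) D^{3/2} (1 + o(1))`, against the
  `(1/√2) D^{3/2}` of the symmetric wall: a factor `0.544`.

Used by `Negative/LevelOneWindowAll.lean` (the level-one member window in every dimension) and
`Negative/LevelOneSmallPrimes.lean` (the level-one slice is empty at every prime `p ≤ 7`, every
dimension).  Sorry-free; standard axioms; no new definitions.  Report: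
`run/shared/lean/b2b/levelgraded-cu/ORACLE-g19.md` §G19-2.
-/

set_option linter.dupNamespace false

noncomputable section

open scoped BigOperators Classical Matrix
open Module (finrank)

namespace Summit.MatrixMultiplication.MatrixMultiplication.Theorems.SubgroupIdentityDesigns.Negative
namespace WitnessNeumannCounts

open Literature.Barriers.MatrixMultiplication (SubgroupTPP)
open Summit.MatrixMultiplication.MatrixMultiplication.Theorems.LieRankDesigns.Negative (GLm Mat)
open Summit.MatrixMultiplication.MatrixMultiplication.Theorems.LevelOneGL2Designs.Negative
  (levelSubmodule levelSubmodule_bi_inv)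
open PackingBridge (exists_test separated card_toFinset)

section General

variable {p m k : ℕ} [hp : Fact p.Prime]

/-- **THE TWO GRADED NEUMANN COUNTS OF A WITNESS.**  A subgroup-TPP triple of `GL_m(𝔽_p)` with a
level-`k` identity design has `|H₁||H₃| + |H₁|(|H₂| − 1) ≤ dim F_k|_G` and
`|H₁||H₃| + (|H₂| − 1)|H₃| ≤ dim F_k|_G`. -/
theorem crux_neumann {H₁ H₂ H₃ : Subgroup (GLm p m)} (htpp : SubgroupTPP H₁ H₂ H₃)
    (hdes : ∃ c : Mat p m → ℂ, (∀ M, k < M.rank → c M = 0) ∧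
      (∑ M, c M * ZMod.stdAddChar (Matrix.trace (M * ((1 : GLm p m) : Mat p m)))) = 1 ∧
      ∀ a ∈ H₁, ∀ b ∈ H₂, ∀ g ∈ H₃, a * b * g ≠ 1 →
        (∑ M, c M * ZMod.stdAddChar (Matrix.trace (M * ((a * b * g : GLm p m) : Mat p m)))) = 0) :
    Nat.card H₁ * Nat.card H₃ + Nat.card H₁ * (Nat.card H₂ - 1) ≤ finrank ℂ (levelSubmodule p m k) ∧
    Nat.card H₁ * Nat.card H₃ + (Nat.card H₂ - 1) * Nat.card H₃ ≤
      finrank ℂ (levelSubmodule p m k) := by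
  classical
  obtain ⟨f, hf, h1, h0⟩ := exists_test hdes
  have hJ := levelSubmodule_bi_inv (p := p) (m := m) (k := k)
  have hr : ∀ f ∈ levelSubmodule p m k, ∀ t : GLm p m,
      (fun g => f (g * t)) ∈ levelSubmodule p m k := fun f hf t => by
    simpa only [one_mul] using hJ f hf 1 t
  have hl : ∀ f ∈ levelSubmodule p m k, ∀ t : GLm p m,
      (fun g => f (t * g)) ∈ levelSubmodule p m k := fun f hf t => by
    simpa only [mul_one] using hJ f hf t 1
  have hsep := separated (levelSubmodule p m k) hJ htpp hf h1 h0 (H₁ : Set (GLm p m)).toFinset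
    (H₂ : Set (GLm p m)).toFinset (H₃ : Set (GLm p m)).toFinset (fun x hx => by simpa using hx)
    (fun y hy => by simpa using hy) (fun z hz => by simpa using hz)
  have h1X : (1 : GLm p m) ∈ (H₁ : Set (GLm p m)).toFinset := by simp [H₁.one_mem]
  have h1Y : (1 : GLm p m) ∈ (H₂ : Set (GLm p m)).toFinset := by simp [H₂.one_mem]
  have h1Z : (1 : GLm p m) ∈ (H₃ : Set (GLm p m)).toFinset := by simp [H₃.one_mem]
  have N1 := LevelTwoBeatsCubes.Negative.packing_X (levelSubmodule p m k) hr _ _ _ hsep h1Y h1Z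
  have N2 := LevelTwoBeatsCubes.Negative.packing_Z (levelSubmodule p m k) hl _ _ _ hsep h1X h1Y
  rw [card_toFinset, card_toFinset, card_toFinset] at N1 N2
  exact ⟨N1, N2⟩

omit hp in
/-- Arithmetic of the counts: `x, z ≥ 1`, `x z + x (y−1) ≤ D`, `x z + (y−1) z ≤ D` give the three
pair walls and, with `u = min (x, z)`, `x y z + u² (u − 1) ≤ u D`, `u² ≤ D`. -/
theorem volume_law_of_counts {x y z D : ℕ} (hx : 1 ≤ x) (hy : 1 ≤ y) (hz : 1 ≤ z)
    (N1 : x * z + x * (y - 1) ≤ D) (N2 : x * z + (y - 1) * z ≤ D) :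
    (x * y ≤ D ∧ y * z ≤ D ∧ x * z ≤ D) ∧
      ∃ u : ℕ, 1 ≤ u ∧ (u = x ∨ u = z) ∧ u ≤ x ∧ u ≤ z ∧ u * u ≤ D ∧
        x * y * z + u * u * (u - 1) ≤ u * D := by
  obtain ⟨y', rfl⟩ : ∃ y', y = y' + 1 := ⟨y - 1, by omega⟩
  obtain ⟨x', rfl⟩ : ∃ x', x = x' + 1 := ⟨x - 1, by omega⟩
  obtain ⟨z', rfl⟩ : ∃ z', z = z' + 1 := ⟨z - 1, by omega⟩
  simp only [Nat.add_sub_cancel] at N1 N2 ⊢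
  have hxz : (x' + 1) * (z' + 1) ≤ D := le_trans (Nat.le_add_right _ _) N1
  refine ⟨⟨?_, ?_, hxz⟩, ?_⟩
  · nlinarith [N1]
  · nlinarith [N2]
  rcases le_total x' z' with h | h
  · refine ⟨x' + 1, by omega, Or.inl rfl, le_rfl, by omega, ?_, ?_⟩
    · calc (x' + 1) * (x' + 1) ≤ (x' + 1) * (z' + 1) := Nat.mul_le_mul_left _ (by omega)
        _ ≤ D := hxz
    · have key : (x' + 1) * ((x' + 1) * (z' + 1) + y' * (z' + 1)) ≤ (x' + 1) * D :=
        Nat.mul_le_mul_left _ N2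
      have hmono : (x' + 1) * (x' + 1) * x' ≤ (x' + 1) * (z' + 1) * x' :=
        Nat.mul_le_mul_right _ (Nat.mul_le_mul_left _ (by omega))
      rw [Nat.add_sub_cancel]
      nlinarith [key, hmono]
  · refine ⟨z' + 1, by omega, Or.inr rfl, by omega, le_rfl, ?_, ?_⟩
    · calc (z' + 1) * (z' + 1) ≤ (x' + 1) * (z' + 1) := Nat.mul_le_mul_right _ (by omega)
        _ ≤ D := hxz
    · have key : ((x' + 1) * (z' + 1) + (x' + 1) * y') * (z' + 1) ≤ D * (z' + 1) :=
        Nat.mul_le_mul_right _ N1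
      have hmono : (z' + 1) * (z' + 1) * z' ≤ (x' + 1) * (z' + 1) * z' :=
        Nat.mul_le_mul_right _ (Nat.mul_le_mul_right _ (by omega))
      rw [Nat.add_sub_cancel]
      nlinarith [key, hmono]

/-- `|H| ≥ 1` for a subgroup of the finite group `GL_m(𝔽_p)`. -/
theorem one_le_card (H : Subgroup (GLm p m)) : 1 ≤ Nat.card H := Nat.card_pos

/-- **THE PAIR WALLS** of a witness (all three pairs): `|Hᵢ||Hⱼ| ≤ dim F_k|_G`. -/
theorem crux_pair_walls {H₁ H₂ H₃ : Subgroup (GLm p m)} (htpp : SubgroupTPP H₁ H₂ H₃)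
    (hdes : ∃ c : Mat p m → ℂ, (∀ M, k < M.rank → c M = 0) ∧
      (∑ M, c M * ZMod.stdAddChar (Matrix.trace (M * ((1 : GLm p m) : Mat p m)))) = 1 ∧
      ∀ a ∈ H₁, ∀ b ∈ H₂, ∀ g ∈ H₃, a * b * g ≠ 1 →
        (∑ M, c M * ZMod.stdAddChar (Matrix.trace (M * ((a * b * g : GLm p m) : Mat p m)))) = 0) :
    Nat.card H₁ * Nat.card H₂ ≤ finrank ℂ (levelSubmodule p m k) ∧
      Nat.card H₂ * Nat.card H₃ ≤ finrank ℂ (levelSubmodule p m k) ∧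
      Nat.card H₁ * Nat.card H₃ ≤ finrank ℂ (levelSubmodule p m k) := by
  obtain ⟨N1, N2⟩ := crux_neumann (k := k) htpp hdes
  exact (volume_law_of_counts (one_le_card H₁) (one_le_card H₂) (one_le_card H₃) N1 N2).1

/-- **THE VOLUME LAW OF A WITNESS.**  With `u = min (|H₁|, |H₃|)` and `D = dim F_k|_G`:
`|H₁||H₂||H₃| + u² (u − 1) ≤ u · D` and `u² ≤ D` — i.e. `V ≤ u D − u³ + u²`. -/
theorem crux_volume_law {H₁ H₂ H₃ : Subgroup (GLm p m)} (htpp : SubgroupTPP H₁ H₂ H₃)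
    (hdes : ∃ c : Mat p m → ℂ, (∀ M, k < M.rank → c M = 0) ∧
      (∑ M, c M * ZMod.stdAddChar (Matrix.trace (M * ((1 : GLm p m) : Mat p m)))) = 1 ∧
      ∀ a ∈ H₁, ∀ b ∈ H₂, ∀ g ∈ H₃, a * b * g ≠ 1 →
        (∑ M, c M * ZMod.stdAddChar (Matrix.trace (M * ((a * b * g : GLm p m) : Mat p m)))) = 0) :
    ∃ u : ℕ, 1 ≤ u ∧ (u = Nat.card H₁ ∨ u = Nat.card H₃) ∧ u ≤ Nat.card H₁ ∧ u ≤ Nat.card H₃ ∧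
      u * u ≤ finrank ℂ (levelSubmodule p m k) ∧
      Nat.card H₁ * Nat.card H₂ * Nat.card H₃ + u * u * (u - 1) ≤
        u * finrank ℂ (levelSubmodule p m k) := by
  obtain ⟨N1, N2⟩ := crux_neumann (k := k) htpp hdes
  exact (volume_law_of_counts (one_le_card H₁) (one_le_card H₂) (one_le_card H₃) N1 N2).2

end General

end WitnessNeumannCounts

end Summit.MatrixMultiplication.MatrixMultiplication.Theorems.SubgroupIdentityDesigns.Negative
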